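import Literature.Analysis.FluidPDE.CarlemanCalculus
import HarnessLib

/-!
# Carleman calculus on `ℝ × E`, II: weights smooth on an open set, general transport identity

Support file for the Carleman inequalities of Escauriaza–Seregin–Šverák (Seregin 2014, App. A.1;
backward-uniqueness track of **ns.S08** `Literature.Analysis.FluidPDE.ess_endpoint`). The first
file `FluidPDE/CarlemanCalculus` handles weights singular on the hyperplane `t = 0` against fields
supported in `{t ≥ δ}`; the second Carleman inequality (Seregin 2014, Prop. 1.3, weight
`φ = -|x'|²/8t + a(1-t) xₙ^{2α}/t^α` on `(ℝⁿ₊ + eₙ) × ]0, 1[`) and the general commutator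
identity (A.1.5)–(A.1.6) need weights that are smooth only on an **open set `Ω` containing the
support** of the field. This file provides that generality:

* gluing (`continuous_of_continuousOn_of_tsupport_subset`, `contDiff_of_contDiffOn_of_tsupport_subset`):
  a function continuous (smooth) on an open `Ω` and vanishing off a closed `K ⊆ Ω` is
  continuous (smooth);
* integration by parts `∫ w ⟪Φ, ∂ᵥΨ⟫ = -∫ ∂ᵥw ⟪Φ, Ψ⟫ - ∫ w ⟪∂ᵥΦ, Ψ⟫` for `w ∈ C¹(Ω)` and
  `Φ` compactly supported in `Ω` (`integral_mul_inner_fderiv_eq_of_open`), the square rule,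
  and **Green's formula in space with a general weight**
  `∫ w ⟪X, ΔₓV⟫ = -Σᵢ ∫ ∂ᵢw ⟪X, ∂ᵢV⟫ - Σᵢ ∫ w ⟪∂ᵢX, ∂ᵢV⟫`;
* the spatial gradient `∇ₓφ` of a scalar weight and the spatial divergence `divₓ Y` of a vector
  field, and the **transport identity** `2 ∫ w ⟪∂_{Y}W, W⟫ = -∫ (∂_{Y} w + w divₓ Y) ‖W‖²`
  (`∂_Y W = DW(0, Y)`), of which the dilation identity (`Y = x`, `divₓ Y = n`) of the first file
  is the special case.

## References

* G. Seregin, *Lecture notes on regularity theory for the Navier–Stokes equations*, World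
  Scientific 2014, Appendix A.1, (A.1.5)–(A.1.6), Prop. 1.3.
* L. Hörmander, *Linear partial differential operators*, Springer 1963, §8.
-/

noncomputable section

open MeasureTheory Set Function Filter Topology
open scoped InnerProductSpace RealInnerProductSpace

namespace Literature.Analysis.FluidPDE

namespace Carleman

/-! ### Gluing across the boundary of an open set -/

section GlueOpen

variable {X : Type*} [TopologicalSpace X]
variable {G : Type*}

/-- **Gluing.** If `f` is continuous on an open set `Ω` and vanishes off a closed set `K ⊆ Ω`,
then `f` is continuous (the open sets `Ω` and `Kᶜ` cover). [folklore] -/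
theorem continuous_of_continuousOn_of_eq_zero [TopologicalSpace G] [Zero G] {f : X → G}
    {Ω K : Set X} (hΩ : IsOpen Ω) (hK : IsClosed K) (hKΩ : K ⊆ Ω) (hf : ContinuousOn f Ω)
    (h0 : ∀ z ∉ K, f z = 0) : Continuous f := by
  rw [continuous_iff_continuousAt]
  intro z
  by_cases hz : z ∈ Ω
  · exact hf.continuousAt (hΩ.mem_nhds hz)
  · have hzK : z ∉ K := fun h => hz (hKΩ h)
    have hev : f =ᶠ[𝓝 z] fun _ => 0 := by
      filter_upwards [hK.isOpen_compl.mem_nhds hzK] with y hy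
      exact h0 y hy
    exact continuousAt_const.congr_of_eventuallyEq hev

end GlueOpen

section GlueOpenSmooth

variable {X : Type*} [NormedAddCommGroup X] [NormedSpace ℝ X]
variable {G : Type*} [NormedAddCommGroup G] [NormedSpace ℝ G]

/-- **Gluing, smooth version.** If `f` is `C^n` on an open set `Ω` and vanishes off a closed set
`K ⊆ Ω`, then `f` is `C^n`. [folklore] -/
theorem contDiff_of_contDiffOn_of_eq_zero {f : X → G} {Ω K : Set X} {n : WithTop ℕ∞}
    (hΩ : IsOpen Ω) (hK : IsClosed K) (hKΩ : K ⊆ Ω) (hf : ContDiffOn ℝ n f Ω)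
    (h0 : ∀ z ∉ K, f z = 0) : ContDiff ℝ n f := by
  rw [contDiff_iff_contDiffAt]
  intro z
  by_cases hz : z ∈ Ω
  · exact hf.contDiffAt (hΩ.mem_nhds hz)
  · have hzK : z ∉ K := fun h => hz (hKΩ h)
    have hev : f =ᶠ[𝓝 z] fun _ => 0 := by
      filter_upwards [hK.isOpen_compl.mem_nhds hzK] with y hy
      exact h0 y hy
    exact contDiffAt_const.congr_of_eventuallyEq hev

omit [NormedSpace ℝ X] in
/-- A product `g • k` with `k` continuous, `tsupport k ⊆ Ω`, and `g` continuous on the open set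
`Ω`, is continuous. [folklore] -/
theorem continuous_smul_of_tsupport_subset {g : X → ℝ} {k : X → G} {Ω : Set X}
    (hΩ : IsOpen Ω) (hg : ContinuousOn g Ω) (hk : Continuous k) (hkΩ : tsupport k ⊆ Ω) :
    Continuous fun z => g z • k z :=
  continuous_of_continuousOn_of_eq_zero hΩ (isClosed_tsupport k) hkΩ (hg.smul hk.continuousOn)
    fun z hz => by simp [image_eq_zero_of_notMem_tsupport hz]

end GlueOpenSmooth

/-! ### Integration by parts with weights of class `C¹` on an open set -/

section IBPOpen

variable {E : Type*} [NormedAddCommGroup E] [InnerProductSpace ℝ E] [FiniteDimensional ℝ E]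
  [MeasurableSpace E] [BorelSpace E]
variable {F : Type*} [NormedAddCommGroup F] [InnerProductSpace ℝ F]
variable {Ω : Set (ℝ × E)}

omit [InnerProductSpace ℝ E] [FiniteDimensional ℝ E] [MeasurableSpace E] [BorelSpace E] in
/-- Pairings `g ⟪A, B⟫` with `A` vanishing off a closed `K ⊆ Ω` (`Ω` open) and all factors
continuous on `Ω` are continuous. [folklore] -/
theorem continuous_mul_inner_of_tsupport_subset {K : Set (ℝ × E)} (hΩ : IsOpen Ω)
    (hK : IsClosed K) (hKΩ : K ⊆ Ω) {g : ℝ × E → ℝ} {A B : ℝ × E → F}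
    (hg : ContinuousOn g Ω) (hA : ContinuousOn A Ω) (hB : ContinuousOn B Ω)
    (h0 : ∀ z ∉ K, A z = 0 ∨ B z = 0) : Continuous fun z => g z * ⟪A z, B z⟫ := by
  refine continuous_of_continuousOn_of_eq_zero hΩ hK hKΩ (hg.mul ?_) fun z hz => ?_
  · exact continuous_inner.comp_continuousOn (hA.prodMk hB)
  · rcases h0 z hz with h | h <;> simp [h]

omit [InnerProductSpace ℝ E] [FiniteDimensional ℝ E] [MeasurableSpace E] [BorelSpace E]
  [InnerProductSpace ℝ F] in
/-- Weighted squares `g ‖W‖²` with `tsupport W ⊆ Ω` and `g` continuous on `Ω` are continuous. [folklore] -/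
theorem continuous_mul_norm_sq_of_tsupport_subset (hΩ : IsOpen Ω) {g : ℝ × E → ℝ}
    {W : ℝ × E → F} (hg : ContinuousOn g Ω) (hW : Continuous W) (hWΩ : tsupport W ⊆ Ω) :
    Continuous fun z => g z * ‖W z‖ ^ 2 := by
  refine continuous_of_continuousOn_of_eq_zero hΩ (isClosed_tsupport W) hWΩ
    (hg.mul (hW.norm.pow 2).continuousOn) fun z hz => ?_
  simp [image_eq_zero_of_notMem_tsupport hz]

/-- **Integration by parts on space–time, weights of class `C¹` on an open set** (no boundary
terms): for an open `Ω ⊆ ℝ × E`, `w ∈ C¹(Ω)`, and `C¹` compactly supported `Φ, Ψ` with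
`tsupport Φ ⊆ Ω`,
`∫ w ⟪Φ, ∂ᵥΨ⟫ = -∫ ∂ᵥw ⟪Φ, Ψ⟫ - ∫ w ⟪∂ᵥΦ, Ψ⟫`.
(`w • Φ` is `C¹` on all of `ℝ × E`, vanishing near every point off `tsupport Φ`; then Mathlib's
`integral_bilinear_hasFDerivAt_right_eq_neg_left_of_integrable`.) [folklore] -/
theorem integral_mul_inner_fderiv_eq_of_open (hΩ : IsOpen Ω) {w : ℝ × E → ℝ}
    {Φ Ψ : ℝ × E → F} (hw : ContDiffOn ℝ 1 w Ω) (hΦ : ContDiff ℝ 1 Φ) (hΨ : ContDiff ℝ 1 Ψ)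
    (hΦc : HasCompactSupport Φ) (hΨc : HasCompactSupport Ψ) (hΦΩ : tsupport Φ ⊆ Ω) (v : ℝ × E) :
    ∫ z, w z * ⟪Φ z, fderiv ℝ Ψ z v⟫ =
      -(∫ z, fderiv ℝ w z v * ⟪Φ z, Ψ z⟫) - ∫ z, w z * ⟪fderiv ℝ Φ z v, Ψ z⟫ := by
  haveI : (volume : Measure (ℝ × E)).IsAddHaarMeasure := Measure.prod.instIsAddHaarMeasure _ _
  set K : Set (ℝ × E) := tsupport Φ with hK
  have hKc : IsClosed K := isClosed_tsupport Φ
  -- continuity and differentiability of the data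
  have cw : ContinuousOn w Ω := hw.continuousOn
  have cΦ : Continuous Φ := hΦ.continuous
  have cΨ : Continuous Ψ := hΨ.continuous
  have cdw : ContinuousOn (fun z => fderiv ℝ w z v) Ω :=
    (hw.continuousOn_fderiv_of_isOpen hΩ le_rfl).clm_apply continuousOn_const
  have cdΦ : Continuous fun z => fderiv ℝ Φ z v :=
    (hΦ.continuous_fderiv one_ne_zero).clm_apply continuous_const
  have cdΨ : Continuous fun z => fderiv ℝ Ψ z v :=
    (hΨ.continuous_fderiv one_ne_zero).clm_apply continuous_const
  have dw : ∀ z ∈ Ω, HasFDerivAt w (fderiv ℝ w z) z := fun z hz =>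
    ((hw.differentiableOn one_ne_zero).differentiableAt (hΩ.mem_nhds hz)).hasFDerivAt
  have dΦ : ∀ z, HasFDerivAt Φ (fderiv ℝ Φ z) z := fun z =>
    (hΦ.differentiable one_ne_zero z).hasFDerivAt
  have dΨ : ∀ z, HasFDerivAt Ψ (fderiv ℝ Ψ z) z := fun z =>
    (hΨ.differentiable one_ne_zero z).hasFDerivAt
  -- vanishing of `Φ`, `DΦ` off `K`
  have hΦ0 : ∀ z ∉ K, Φ z = 0 := fun z hz => image_eq_zero_of_notMem_tsupport hz
  have hdΦ0 : ∀ z ∉ K, fderiv ℝ Φ z = 0 := fun z hz => fderiv_of_notMem_tsupport (𝕜 := ℝ) hz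
  -- the pair `(w • Φ, Ψ)`
  set f : ℝ × E → F := fun z => w z • Φ z with hf
  set f' : ℝ × E → (ℝ × E →L[ℝ] F) := fun z =>
    w z • fderiv ℝ Φ z + (fderiv ℝ w z).smulRight (Φ z) with hf'
  have df : ∀ z, HasFDerivAt f (f' z) z := by
    intro z
    by_cases hz : z ∈ Ω
    · exact (dw z hz).smul (dΦ z)
    · have hzK : z ∉ K := fun h => hz (hΦΩ h)
      have hev : f =ᶠ[𝓝 z] fun _ => 0 := by
        filter_upwards [hKc.isOpen_compl.mem_nhds hzK] with y hy
        simp [hf, hΦ0 y hy]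
      have h0 : f' z = 0 := by
        simp [hf', hΦ0 z hzK, hdΦ0 z hzK]
      rw [h0]
      exact (hasFDerivAt_const (0 : F) z).congr_of_eventuallyEq hev
  have hf'v : ∀ z, f' z v = w z • fderiv ℝ Φ z v + fderiv ℝ w z v • Φ z := fun z => by
    simp [hf', add_comm]
  set B : F →L[ℝ] F →L[ℝ] ℝ := innerSL ℝ with hB
  have hBapp : ∀ a b : F, B a b = ⟪a, b⟫ := fun a b => rfl
  -- integrability of the three products
  have i1 : Integrable (fun z => B (f' z v) (Ψ z)) := by
    refine integrable_of_continuous_hasCompactSupport ?_ ?_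
    · simp_rw [hBapp, hf'v]
      have := continuous_mul_inner_of_tsupport_subset hΩ hKc hΦΩ (g := fun _ => (1 : ℝ))
        (A := fun z => w z • fderiv ℝ Φ z v + fderiv ℝ w z v • Φ z) (B := Ψ) continuousOn_const
        ((cw.smul cdΦ.continuousOn).add (cdw.smul cΦ.continuousOn)) cΨ.continuousOn
        (fun z hz => Or.inl (by simp [hΦ0 z hz, hdΦ0 z hz]))
      simpa using this
    · exact hΨc.mono fun z hz => by
        contrapose! hz
        simp [hBapp, notMem_support.1 hz]
  have i2 : Integrable (fun z => B (f z) (fderiv ℝ Ψ z v)) := by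
    refine integrable_of_continuous_hasCompactSupport ?_ ?_
    · simp_rw [hBapp, hf]
      have := continuous_mul_inner_of_tsupport_subset hΩ hKc hΦΩ (g := fun _ => (1 : ℝ))
        (A := fun z => w z • Φ z) (B := fun z => fderiv ℝ Ψ z v) continuousOn_const
        (cw.smul cΦ.continuousOn) cdΨ.continuousOn
        (fun z hz => Or.inl (by simp [hΦ0 z hz]))
      simpa using this
    · exact hΦc.mono fun z hz => by
        contrapose! hz
        simp [hBapp, hf, notMem_support.1 hz]
  have i3 : Integrable (fun z => B (f z) (Ψ z)) := by
    refine integrable_of_continuous_hasCompactSupport ?_ ?_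
    · simp_rw [hBapp, hf]
      have := continuous_mul_inner_of_tsupport_subset hΩ hKc hΦΩ (g := fun _ => (1 : ℝ))
        (A := fun z => w z • Φ z) (B := Ψ) continuousOn_const
        (cw.smul cΦ.continuousOn) cΨ.continuousOn
        (fun z hz => Or.inl (by simp [hΦ0 z hz]))
      simpa using this
    · exact hΦc.mono fun z hz => by
        contrapose! hz
        simp [hBapp, hf, notMem_support.1 hz]
  have key := integral_bilinear_hasFDerivAt_right_eq_neg_left_of_integrable (μ := volume)
    (B := B) i1 i2 i3 (fun z _ => df z) (fun z _ => dΨ z)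
  -- rewrite both sides
  have lhs : ∫ z, B (f z) (fderiv ℝ Ψ z v) = ∫ z, w z * ⟪Φ z, fderiv ℝ Ψ z v⟫ :=
    integral_congr_ae (Eventually.of_forall fun z => by
      simp only [hBapp, hf, real_inner_smul_left])
  have j1 : Integrable (fun z => w z * ⟪fderiv ℝ Φ z v, Ψ z⟫) :=
    integrable_of_continuous_hasCompactSupport
      (continuous_mul_inner_of_tsupport_subset hΩ hKc hΦΩ cw cdΦ.continuousOn cΨ.continuousOn
        (fun z hz => Or.inl (by simp [hdΦ0 z hz])))
      (hasCompactSupport_mul_inner_right hΨc)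
  have j2 : Integrable (fun z => fderiv ℝ w z v * ⟪Φ z, Ψ z⟫) :=
    integrable_of_continuous_hasCompactSupport
      (continuous_mul_inner_of_tsupport_subset hΩ hKc hΦΩ cdw cΦ.continuousOn cΨ.continuousOn
        (fun z hz => Or.inl (hΦ0 z hz)))
      (hasCompactSupport_mul_inner_right hΨc)
  have rhs : ∫ z, B (f' z v) (Ψ z) =
      (∫ z, w z * ⟪fderiv ℝ Φ z v, Ψ z⟫) + ∫ z, fderiv ℝ w z v * ⟪Φ z, Ψ z⟫ := by
    rw [← integral_add j1 j2]
    refine integral_congr_ae (Eventually.of_forall fun z => ?_)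
    simp only [hBapp, hf'v, inner_add_left, real_inner_smul_left]
  rw [← lhs, key, rhs]
  ring

/-- **Square rule**, weights `C¹` on an open set: `2 ∫ w ⟪W, ∂ᵥW⟫ = -∫ ∂ᵥw ‖W‖²` for `W`
compactly supported with `tsupport W ⊆ Ω`. [folklore] -/
theorem two_mul_integral_mul_inner_fderiv_self_of_open (hΩ : IsOpen Ω) {w : ℝ × E → ℝ}
    {W : ℝ × E → F} (hw : ContDiffOn ℝ 1 w Ω) (hW : ContDiff ℝ 1 W) (hWc : HasCompactSupport W)
    (hWΩ : tsupport W ⊆ Ω) (v : ℝ × E) :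
    2 * ∫ z, w z * ⟪W z, fderiv ℝ W z v⟫ = -∫ z, fderiv ℝ w z v * ‖W z‖ ^ 2 := by
  have h := integral_mul_inner_fderiv_eq_of_open hΩ hw hW hW hWc hWc hWΩ v
  have e : ∫ z, w z * ⟪fderiv ℝ W z v, W z⟫ = ∫ z, w z * ⟪W z, fderiv ℝ W z v⟫ :=
    integral_congr_ae (Eventually.of_forall fun z => by
      show w z * ⟪fderiv ℝ W z v, W z⟫ = w z * ⟪W z, fderiv ℝ W z v⟫
      rw [real_inner_comm])
  have e2 : ∫ z, fderiv ℝ w z v * ⟪W z, W z⟫ = ∫ z, fderiv ℝ w z v * ‖W z‖ ^ 2 :=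
    integral_congr_ae (Eventually.of_forall fun z => by
      show fderiv ℝ w z v * ⟪W z, W z⟫ = fderiv ℝ w z v * ‖W z‖ ^ 2
      rw [real_inner_self_eq_norm_sq])
  rw [e] at h
  linarith

/-- **Green's formula in space with a general weight**: for `w ∈ C¹(Ω)`, `X` of class `C¹`,
compactly supported with `tsupport X ⊆ Ω`, and `V` smooth compactly supported,
`∫ w ⟪X, ΔₓV⟫ = -Σᵢ ∫ ∂ᵢw ⟪X, ∂ᵢV⟫ - Σᵢ ∫ w ⟪∂ᵢX, ∂ᵢV⟫`. [folklore] -/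
theorem integral_mul_inner_lap_of_open (hΩ : IsOpen Ω) {w : ℝ × E → ℝ} {X V : ℝ × E → F}
    (hw : ContDiffOn ℝ 1 w Ω) (hX : ContDiff ℝ 1 X) (hXc : HasCompactSupport X)
    (hXΩ : tsupport X ⊆ Ω) (hV : ContDiff ℝ (⊤ : ℕ∞) V) (hVc : HasCompactSupport V) :
    ∫ z, w z * ⟪X z, lap V z⟫ =
      -(∑ i, ∫ z, fderiv ℝ w z (0, stdOrthonormalBasis ℝ E i) *
          ⟪X z, dx (stdOrthonormalBasis ℝ E i) V z⟫) -
        ∑ i, ∫ z, w z * ⟪dx (stdOrthonormalBasis ℝ E i) X z, dx (stdOrthonormalBasis ℝ E i) V z⟫ := by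
  set b := stdOrthonormalBasis ℝ E with hb
  have hdV1 : ∀ i, ContDiff ℝ 1 (dx (b i) V) := fun i =>
    (contDiff_dx hV (b i)).of_le (by exact_mod_cast le_top)
  have step : ∀ i, ∫ z, w z * ⟪X z, dx (b i) (dx (b i) V) z⟫ =
      -(∫ z, fderiv ℝ w z (0, b i) * ⟪X z, dx (b i) V z⟫) -
        ∫ z, w z * ⟪dx (b i) X z, dx (b i) V z⟫ := by
    intro i
    have h := integral_mul_inner_fderiv_eq_of_open hΩ hw hX (hdV1 i) hXc
      (hasCompactSupport_dx hVc _) hXΩ (0, b i)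
    simpa only [dx_apply] using h
  have hint : ∀ i, Integrable fun z => w z * ⟪X z, dx (b i) (dx (b i) V) z⟫ := fun i =>
    integrable_of_continuous_hasCompactSupport
      (continuous_mul_inner_of_tsupport_subset hΩ (isClosed_tsupport X) hXΩ hw.continuousOn
        hX.continuous.continuousOn (contDiff_dx (contDiff_dx hV _) _).continuous.continuousOn
        fun z hz => Or.inl (image_eq_zero_of_notMem_tsupport hz))
      (hasCompactSupport_mul_inner_left hXc)
  calc ∫ z, w z * ⟪X z, lap V z⟫
      = ∫ z, ∑ i, w z * ⟪X z, dx (b i) (dx (b i) V) z⟫ := by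
        refine integral_congr_ae (Eventually.of_forall fun z => ?_)
        show w z * ⟪X z, lap V z⟫ = ∑ i, w z * ⟪X z, dx (b i) (dx (b i) V) z⟫
        rw [lap, ← Finset.mul_sum, ← inner_sum]
    _ = ∑ i, ∫ z, w z * ⟪X z, dx (b i) (dx (b i) V) z⟫ := integral_finsetSum _ fun i _ => hint i
    _ = ∑ i, (-(∫ z, fderiv ℝ w z (0, b i) * ⟪X z, dx (b i) V z⟫) -
          ∫ z, w z * ⟪dx (b i) X z, dx (b i) V z⟫) := Finset.sum_congr rfl fun i _ => step i
    _ = -(∑ i, ∫ z, fderiv ℝ w z (0, b i) * ⟪X z, dx (b i) V z⟫) -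
          ∑ i, ∫ z, w z * ⟪dx (b i) X z, dx (b i) V z⟫ := by
        rw [Finset.sum_sub_distrib, Finset.sum_neg_distrib]

end IBPOpen

/-! ### Spatial gradient of a weight, spatial divergence, and the transport identity -/

section Transport

variable {E : Type*} [NormedAddCommGroup E] [InnerProductSpace ℝ E] [FiniteDimensional ℝ E]
  [MeasurableSpace E] [BorelSpace E]
variable {F : Type*} [NormedAddCommGroup F] [InnerProductSpace ℝ F]

/-- The spatial gradient `∇ₓφ (t, x) = Σᵢ ∂ᵢφ bᵢ ∈ E` of a scalar weight (so that
`Dφ(z)(0, e) = ⟪∇ₓφ(z), e⟫`). [cite: Seregin2014, App. A.1 (A.1.13)] -/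
def gradX (φ : ℝ × E → ℝ) (z : ℝ × E) : E :=
  ∑ i, dx (stdOrthonormalBasis ℝ E i) φ z • stdOrthonormalBasis ℝ E i

/-- The spatial divergence `divₓ Y = Σᵢ ⟪∂ᵢY, bᵢ⟫` of a vector field `Y : ℝ × E → E`. [folklore] -/
def divX (Y : ℝ × E → E) (z : ℝ × E) : ℝ :=
  ∑ i, ⟪dx (stdOrthonormalBasis ℝ E i) Y z, stdOrthonormalBasis ℝ E i⟫

omit [MeasurableSpace E] [BorelSpace E] in
/-- `⟪∇ₓφ(z), e⟫ = Dφ(z)(0, e)`. [folklore] -/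
theorem inner_gradX (φ : ℝ × E → ℝ) (z : ℝ × E) (e : E) :
    ⟪gradX φ z, e⟫ = fderiv ℝ φ z (0, e) := by
  set b := stdOrthonormalBasis ℝ E with hb
  rw [gradX, sum_inner]
  simp_rw [real_inner_smul_left, dx_apply]
  rw [prod_zero_eq_sum e, map_sum]
  simp_rw [map_smul, smul_eq_mul]
  refine Finset.sum_congr rfl fun i _ => ?_
  rw [real_inner_comm]
  ring

omit [MeasurableSpace E] [BorelSpace E] in
/-- The coordinates of `∇ₓφ`: `⟪∇ₓφ, bᵢ⟫ = ∂ᵢφ`. [folklore] -/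
theorem inner_gradX_basis (φ : ℝ × E → ℝ) (z : ℝ × E) (i : Fin (Module.finrank ℝ E)) :
    ⟪gradX φ z, stdOrthonormalBasis ℝ E i⟫ = dx (stdOrthonormalBasis ℝ E i) φ z := by
  rw [inner_gradX, dx_apply]

omit [MeasurableSpace E] [BorelSpace E] in
/-- `‖∇ₓφ‖² = Σᵢ (∂ᵢφ)² = |∇ₓφ|²` (`gradSq` of the scalar weight). [folklore] -/
theorem norm_gradX_sq (φ : ℝ × E → ℝ) (z : ℝ × E) : ‖gradX φ z‖ ^ 2 = gradSq φ z := by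
  set b := stdOrthonormalBasis ℝ E with hb
  rw [← b.sum_sq_inner_left (gradX φ z), gradSq]
  refine Finset.sum_congr rfl fun i _ => ?_
  rw [inner_gradX_basis, Real.norm_eq_abs, sq_abs]

omit [MeasurableSpace E] [BorelSpace E] in
/-- The derivative along the gradient: `DW(0, ∇ₓφ) = Σᵢ ∂ᵢφ ∂ᵢW`. [folklore] -/
theorem fderiv_apply_gradX {G : Type*} [NormedAddCommGroup G] [NormedSpace ℝ G]
    (φ : ℝ × E → ℝ) (W : ℝ × E → G) (z : ℝ × E) :
    fderiv ℝ W z (0, gradX φ z) =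
      ∑ i, dx (stdOrthonormalBasis ℝ E i) φ z • dx (stdOrthonormalBasis ℝ E i) W z := by
  set b := stdOrthonormalBasis ℝ E with hb
  have hx : ((0 : ℝ), gradX φ z) = ∑ i, dx (b i) φ z • (((0 : ℝ), b i) : ℝ × E) := by
    ext
    · simp [Prod.fst_sum]
    · simp only [Prod.snd_sum, Prod.smul_snd, gradX]
      rfl
  rw [hx, map_sum]
  simp only [map_smul, dx_apply]

omit [MeasurableSpace E] [BorelSpace E] in
/-- Spatial divergence of `z ↦ x` is `n`. [folklore] -/
theorem divX_snd : divX (fun z : ℝ × E => z.2) = fun _ => (Module.finrank ℝ E : ℝ) := by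
  funext z
  simp only [divX, dx_apply, fderiv_snd, ContinuousLinearMap.coe_snd']
  simp

variable {Ω : Set (ℝ × E)}

/-- **The transport identity**: for an open `Ω`, a weight `w ∈ C¹(Ω)`, a vector field
`Y ∈ C¹(Ω; E)` and a `C¹` compactly supported `W` with `tsupport W ⊆ Ω`,
`2 ∫ w ⟪DW(0, Y), W⟫ = -∫ (Dw(0, Y) + w divₓ Y) ‖W‖²`
(sum over the frame of the square rule with the weights `w Yⱼ`, `∂ⱼ(w Yⱼ) = Yⱼ ∂ⱼw + w ∂ⱼYⱼ`;
`∫ (wY)·∇|W|² = -∫ div(wY) |W|²`). [folklore] -/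
theorem two_mul_integral_mul_inner_fderiv_field_self (hΩ : IsOpen Ω) {w : ℝ × E → ℝ}
    {Y : ℝ × E → E} {W : ℝ × E → F} (hw : ContDiffOn ℝ 1 w Ω) (hY : ContDiffOn ℝ 1 Y Ω)
    (hW : ContDiff ℝ 1 W) (hWc : HasCompactSupport W) (hWΩ : tsupport W ⊆ Ω) :
    2 * ∫ z, w z * ⟪fderiv ℝ W z (0, Y z), W z⟫ =
      -∫ z, (fderiv ℝ w z (0, Y z) + w z * divX Y z) * ‖W z‖ ^ 2 := by
  set b := stdOrthonormalBasis ℝ E with hb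
  have cw : ContinuousOn w Ω := hw.continuousOn
  have cY : ContinuousOn Y Ω := hY.continuousOn
  have cW : Continuous W := hW.continuous
  have cdw : ∀ v, ContinuousOn (fun z => fderiv ℝ w z v) Ω := fun v =>
    (hw.continuousOn_fderiv_of_isOpen hΩ le_rfl).clm_apply continuousOn_const
  have cdY : ∀ v, ContinuousOn (fun z => fderiv ℝ Y z v) Ω := fun v =>
    (hY.continuousOn_fderiv_of_isOpen hΩ le_rfl).clm_apply continuousOn_const
  have cdW : ∀ v, Continuous fun z => fderiv ℝ W z v := fun v =>
    (hW.continuous_fderiv one_ne_zero).clm_apply continuous_const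
  have hW0 : ∀ z ∉ tsupport W, W z = 0 := fun z hz => image_eq_zero_of_notMem_tsupport hz
  -- the weights `w Yⱼ`, `Yⱼ = ⟪Y, bⱼ⟫`, and `∂ⱼ(w Yⱼ) = Yⱼ ∂ⱼw + w ⟪∂ⱼY, bⱼ⟫` on `Ω`
  have hYj : ∀ j, ContDiffOn ℝ 1 (fun z => ⟪Y z, b j⟫) Ω := fun j => hY.inner ℝ contDiffOn_const
  have hwj : ∀ j, ContDiffOn ℝ 1 (fun z => w z * ⟪Y z, b j⟫) Ω := fun j => hw.mul (hYj j)
  have hdwj : ∀ j, ∀ z ∈ Ω, fderiv ℝ (fun y => w y * ⟪Y y, b j⟫) z (0, b j) =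
      fderiv ℝ w z (0, b j) * ⟪Y z, b j⟫ + w z * ⟪fderiv ℝ Y z (0, b j), b j⟫ := by
    intro j z hz
    have hwd : DifferentiableAt ℝ w z :=
      (hw.differentiableOn one_ne_zero).differentiableAt (hΩ.mem_nhds hz)
    have hYd : DifferentiableAt ℝ Y z :=
      (hY.differentiableOn one_ne_zero).differentiableAt (hΩ.mem_nhds hz)
    have hYjd : DifferentiableAt ℝ (fun y => ⟪Y y, b j⟫) z := hYd.inner ℝ (differentiableAt_const _)
    rw [fderiv_fun_mul hwd hYjd]
    simp only [_root_.add_apply, _root_.smul_apply, smul_eq_mul]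
    rw [fderiv_inner_apply ℝ hYd (differentiableAt_const _)]
    have h0 : fderiv ℝ (fun _ : ℝ × E => b j) z (0, b j) = 0 := by
      rw [fderiv_fun_const]; rfl
    rw [h0, inner_zero_right, zero_add]
    ring
  -- expand `DW(0, Y)` in the frame and integrate term by term
  have hexp : ∀ z, w z * ⟪fderiv ℝ W z (0, Y z), W z⟫ =
      ∑ j, (w z * ⟪Y z, b j⟫) * ⟪W z, fderiv ℝ W z (0, b j)⟫ := by
    intro z
    rw [prod_zero_eq_sum (Y z), map_sum, sum_inner, Finset.mul_sum]
    refine Finset.sum_congr rfl fun j _ => ?_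
    rw [map_smul, real_inner_smul_left, real_inner_comm (W z)]
    ring
  have hint : ∀ j, Integrable fun z => (w z * ⟪Y z, b j⟫) * ⟪W z, fderiv ℝ W z (0, b j)⟫ :=
    fun j => integrable_of_continuous_hasCompactSupport
      (continuous_mul_inner_of_tsupport_subset hΩ (isClosed_tsupport W) hWΩ
        (cw.mul (hYj j).continuousOn) cW.continuousOn (cdW _).continuousOn fun z hz => Or.inl (hW0 z hz))
      (hasCompactSupport_mul_inner_left hWc)
  have hint2 : ∀ j, Integrable fun z =>
      (fderiv ℝ w z (0, b j) * ⟪Y z, b j⟫ + w z * ⟪fderiv ℝ Y z (0, b j), b j⟫) * ‖W z‖ ^ 2 := fun j =>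
    integrable_of_continuous_hasCompactSupport
      (continuous_mul_norm_sq_of_tsupport_subset hΩ
        (((cdw _).mul (hYj j).continuousOn).add (cw.mul ((cdY _).inner continuousOn_const))) cW hWΩ)
      (hasCompactSupport_mul_norm_sq hWc)
  have step1 : ∫ z, w z * ⟪fderiv ℝ W z (0, Y z), W z⟫ =
      ∑ j, ∫ z, (w z * ⟪Y z, b j⟫) * ⟪W z, fderiv ℝ W z (0, b j)⟫ := by
    rw [← integral_finsetSum _ fun j _ => hint j]
    exact integral_congr_ae (Eventually.of_forall hexp)
  have step2 : ∀ j, 2 * ∫ z, (w z * ⟪Y z, b j⟫) * ⟪W z, fderiv ℝ W z (0, b j)⟫ =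
      -∫ z, (fderiv ℝ w z (0, b j) * ⟪Y z, b j⟫ + w z * ⟪fderiv ℝ Y z (0, b j), b j⟫) *
        ‖W z‖ ^ 2 := by
    intro j
    rw [two_mul_integral_mul_inner_fderiv_self_of_open hΩ (hwj j) hW hWc hWΩ (0, b j)]
    congr 1
    refine integral_congr_ae (Eventually.of_forall fun z => ?_)
    by_cases hz : z ∈ Ω
    · simp only [hdwj j z hz]
    · have : W z = 0 := hW0 z fun h => hz (hWΩ h)
      simp [this]
  have hsum : ∀ z, ∑ j, (fderiv ℝ w z (0, b j) * ⟪Y z, b j⟫ + w z * ⟪fderiv ℝ Y z (0, b j), b j⟫) *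
      ‖W z‖ ^ 2 = (fderiv ℝ w z (0, Y z) + w z * divX Y z) * ‖W z‖ ^ 2 := by
    intro z
    rw [← Finset.sum_mul, Finset.sum_add_distrib, ← Finset.mul_sum, fderiv_apply_zero_eq_sum w z (Y z)]
    congr 2
    · exact Finset.sum_congr rfl fun j _ => mul_comm _ _
  calc 2 * ∫ z, w z * ⟪fderiv ℝ W z (0, Y z), W z⟫
      = ∑ j, 2 * ∫ z, (w z * ⟪Y z, b j⟫) * ⟪W z, fderiv ℝ W z (0, b j)⟫ := by
        rw [step1, Finset.mul_sum]
    _ = ∑ j, -∫ z, (fderiv ℝ w z (0, b j) * ⟪Y z, b j⟫ + w z * ⟪fderiv ℝ Y z (0, b j), b j⟫) *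
          ‖W z‖ ^ 2 := Finset.sum_congr rfl fun j _ => step2 j
    _ = -∫ z, ∑ j, (fderiv ℝ w z (0, b j) * ⟪Y z, b j⟫ + w z * ⟪fderiv ℝ Y z (0, b j), b j⟫) *
          ‖W z‖ ^ 2 := by
        rw [Finset.sum_neg_distrib, integral_finsetSum _ fun j _ => hint2 j]
    _ = -∫ z, (fderiv ℝ w z (0, Y z) + w z * divX Y z) * ‖W z‖ ^ 2 := by
        congr 1
        exact integral_congr_ae (Eventually.of_forall hsum)

end Transport

end Carleman

end Literature.Analysis.FluidPDE
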